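import Summits.QuantumFields.YangMills.Theorems.AllWindowsColdBoxBoxHighLineStep2Defs
import Summits.QuantumFields.YangMills.Theorems.AllWindowsColdBoxBoxHighLineGaussianWeightTails
import Summits.QuantumFields.YangMills.Theorems.AllWindowsColdBoxBoxHighLineLaplaceSandwichPauliFlat
import Summits.QuantumFields.YangMills.Theorems.AllWindowsColdBoxBoxHighLineGaussianColourCopies
import Summits.QuantumFields.YangMills.Theorems.AllWindowsColdBoxBoxHighLineKernelHodgeForm

/-!
# T-S5.6 input (6d, chart letters): the chart Gaussian `e^{−β′·boxQuadForm}` has RELATIVELY small mass off the small-field box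
# (STUB-PLAN-S5-STEP2 §5 T-S5.6 `SmallFieldInsideFP`, «numerator = union over edges of single-edge Gaussian tails», planner ym-idea-2 g18 19:07:07Z;
# LINE-19 S5 ⟨stmt-QuantumFields-24004⟩/⟨24335⟩, LINE-20 U5 ⟨24336⟩; objects from ✓`…Step2Defs` BY NAME)

Width seat `ym-line-sfw-p2-w4` (prover-ym-line-sfw-p2-w4-g27-0).  Transport of fcl-p3's per-coordinate RELATIVE Chernoff tail
✓`LaplaceSandwich.setIntegral_exists_coord_tail_le` (`∫_{∃i, ρ ≤ |vᵢ|} e^{−½vᵀPv} ≤ 2(Σᵢ e^{−ρ²/(2(P⁻¹)ᵢᵢ)})·Z(P)`) to the edge chart `a : LandauFree H → E3`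
through the volume-preserving flattening ✓`LaplaceSandwich.flatten` and the colour/Kronecker identity ✓`GaussianChartWick.dotProduct_kronecker_one_mulVec`:
* **`boxQuadForm_eq_flat`** — `boxQuadForm H a = ♭a ⬝ᵥ ((hodgeQ H ⊗ₖ 1₃) *ᵥ ♭a)`; `neg_mul_boxQuadForm_eq` (the `½`-convention precision `P = (2β′)·(hodgeQ ⊗ₖ 1₃)`);
* `integral_exp_neg_mul_boxQuadForm` — the chart Gaussian mass `∫ e^{−β′Q} = √(2π)^{3n}/√det P` (✓`Beta.GaussianIntegral.integral_exp_neg_half_quadForm`);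
* `exists_coord_of_not_smallField` — off `smallField H s` some flat coordinate has `|♭a (e,c)| ≥ s/√3`;
* **`setIntegral_compl_smallField_exp_le`** — for `β′ > 0`, `s ≥ 0` and a variance bound `(hodgeQ H)⁻¹ₑₑ ≤ C₃` (✓S3a `landauVarianceBounded` supplies it):
  `∫_{a ∉ smallField H s} e^{−β′·boxQuadForm H a} ≤ 6·|LandauFree H|·e^{−β′s²/(3C₃)} · ∫ e^{−β′·boxQuadForm H a}` — the `C·H⁴·e^{−cβs²}` of T-S5.6
  (numerator with `β′ = β(1−ε)`; the DENOMINATOR bound on `smallField H (s/2)` is the same lemma at `s/2` via `∫_S + ∫_{Sᶜ} = ∫`).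

Everything proved; no definitions; standard axioms.  HONEST LABEL: an input of the OPEN task T-S5.6 of STEP 2 of the XL stub S5 of a critic-PASSed DRAFT line on the
R2ξ″ cruxes; T-S5.6, S5, U5 and the items ⟨24004⟩ ⟨24335⟩ ⟨24336⟩ remain OPEN; no stub is closed by name, no crux, rung or summit is proved; the Yang–Mills
mass gap is NOT proved by this file.
-/

set_option autoImplicit false

open MeasureTheory Matrix Finset Real
open scoped Kronecker

namespace Summit.QuantumFields.YangMills.Theorems.AllWindowsColdBoxBoxHighLine

namespace ChartGauss

open LaplaceSandwich GaussianChartWick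

variable {H : ℕ}

/-! ## The chart Gaussian as a flat quadratic form -/

/-- **`boxQuadForm H a = ♭a ⬝ᵥ ((hodgeQ H ⊗ₖ 1₃) *ᵥ ♭a)`** (colour by colour). -/
theorem boxQuadForm_eq_flat (a : LandauFree H → E3) :
    boxQuadForm H a = flatten (LandauFree H) a ⬝ᵥ ((hodgeQ H ⊗ₖ (1 : Matrix (Fin 3) (Fin 3) ℝ)) *ᵥ flatten (LandauFree H) a) := by
  rw [dotProduct_kronecker_one_mulVec, boxQuadForm]
  rfl

/-- The exponent in the `½`-convention: `−β′·Q(a) = −½ · ♭a ⬝ᵥ (((2β′)·(hodgeQ ⊗ₖ 1₃)) *ᵥ ♭a)`. -/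
theorem neg_mul_boxQuadForm_eq (β' : ℝ) (a : LandauFree H → E3) :
    -(β' * boxQuadForm H a) =
      -(1/2 : ℝ) * (flatten (LandauFree H) a ⬝ᵥ (((2 * β') • (hodgeQ H ⊗ₖ (1 : Matrix (Fin 3) (Fin 3) ℝ))) *ᵥ flatten (LandauFree H) a)) := by
  rw [Matrix.smul_mulVec, dotProduct_smul, smul_eq_mul, boxQuadForm_eq_flat]
  ring

/-- The precision `(2β′)·(hodgeQ ⊗ₖ 1₃)` is positive definite for `β′ > 0`. -/
theorem posDef_precision {β' : ℝ} (hβ : 0 < β') :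
    ((2 * β') • (hodgeQ H ⊗ₖ (1 : Matrix (Fin 3) (Fin 3) ℝ))).PosDef :=
  (posDef_kronecker_one (hodgeQ H) (hodgeQ_posDef H)).smul (by positivity)

/-- **The chart Gaussian mass**: `∫ e^{−β′·boxQuadForm H a} da = √(2π)^{3n} / √det((2β′)·(hodgeQ ⊗ₖ 1₃))`. -/
theorem integral_exp_neg_mul_boxQuadForm {β' : ℝ} (hβ : 0 < β') :
    ∫ a : LandauFree H → E3, Real.exp (-(β' * boxQuadForm H a)) =
      Real.sqrt (2 * Real.pi) ^ Fintype.card (LandauFree H × Fin 3) /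
        Real.sqrt ((2 * β') • (hodgeQ H ⊗ₖ (1 : Matrix (Fin 3) (Fin 3) ℝ))).det := by
  rw [← Literature.MathematicalPhysics.QuantumFieldTheory.Balaban1983to89.Beta.GaussianIntegral.integral_exp_neg_half_quadForm _
    (posDef_precision hβ), ← (volume_preserving_flatten (LandauFree H)).integral_comp (flatten (LandauFree H)).measurableEmbedding]
  refine integral_congr_ae (ae_of_all _ fun a => ?_)
  simp only [neg_mul_boxQuadForm_eq]

/-! ## Off the small-field box some flat coordinate is large -/

/-- **Off `smallField H s` some flat coordinate has `|♭a (e,c)| ≥ s/√3`.** -/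
theorem exists_coord_of_not_smallField {s : ℝ} {a : LandauFree H → E3} (ha : a ∉ smallField H s) :
    ∃ p : LandauFree H × Fin 3, s / Real.sqrt 3 ≤ |flatten (LandauFree H) a p| := by
  by_contra hne
  push Not at hne
  apply ha
  intro e
  by_cases hs : 0 ≤ s
  · have h3 : ‖a e‖ ^ 2 ≤ 3 * (s / Real.sqrt 3) ^ 2 :=
      norm_sq_le_three_mul_sq (LandauFree H) fun c => (hne (e, c)).le
    have hs3 : 3 * (s / Real.sqrt 3) ^ 2 = s ^ 2 := by
      rw [div_pow, Real.sq_sqrt (by norm_num : (0:ℝ) ≤ 3)]; ring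
    rw [hs3] at h3
    exact (pow_le_pow_iff_left₀ (norm_nonneg _) hs two_ne_zero).1 h3
  · exfalso
    have h1 := hne (e, 0)
    have h0 : (0 : ℝ) ≤ |flatten (LandauFree H) a (e, 0)| := abs_nonneg _
    have h2 : s / Real.sqrt 3 < 0 := div_neg_of_neg_of_pos (lt_of_not_ge hs) (Real.sqrt_pos.2 (by norm_num))
    linarith

/-- The small-field box is closed, hence measurable. -/
theorem measurableSet_smallField (s : ℝ) : MeasurableSet (smallField H s) := by
  have h : smallField H s = ⋂ e : LandauFree H, {a : LandauFree H → E3 | ‖a e‖ ≤ s} := by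
    ext a; simp [smallField]
  rw [h]
  refine (isClosed_iInter fun e => ?_).measurableSet
  exact isClosed_le ((continuous_apply e).norm) continuous_const

/-! ## The relative tail bound -/

/-- Step 1 (transport): the chart integral off the small-field box is at most the flat Gaussian integral over the coordinate tail set. -/
theorem setIntegral_compl_smallField_le_flat {β' : ℝ} (hβ : 0 < β') (s : ℝ) :
    ∫ a in (smallField H s)ᶜ, Real.exp (-(β' * boxQuadForm H a)) ≤
      ∫ v in {v : LandauFree H × Fin 3 → ℝ | ∃ p, s / Real.sqrt 3 ≤ |v p|},
        Real.exp (-(1/2 : ℝ) * (v ⬝ᵥ ((2 * β') • (hodgeQ H ⊗ₖ (1 : Matrix (Fin 3) (Fin 3) ℝ))) *ᵥ v)) := by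
  have hPd := posDef_precision (H := H) hβ
  have hmeasT : MeasurableSet {v : LandauFree H × Fin 3 → ℝ | ∃ p, s / Real.sqrt 3 ≤ |v p|} :=
    measurableSet_exists_coord_tail (s / Real.sqrt 3)
  have hfi := Literature.MathematicalPhysics.QuantumFieldTheory.Balaban1983to89.Beta.GaussianIntegral.integrable_exp_neg_half_quadForm _ hPd
  rw [← integral_indicator (measurableSet_smallField s).compl, ← integral_indicator hmeasT,
    ← (volume_preserving_flatten (LandauFree H)).integral_comp (flatten (LandauFree H)).measurableEmbedding]
  have hint := ((volume_preserving_flatten (LandauFree H)).integrable_comp_emb (flatten (LandauFree H)).measurableEmbedding).2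
    (hfi.indicator hmeasT)
  refine integral_mono_of_nonneg (ae_of_all _ fun a => Set.indicator_nonneg (fun _ _ => (Real.exp_pos _).le) _) hint
    (ae_of_all _ fun a => ?_)
  show (smallField H s)ᶜ.indicator (fun a => Real.exp (-(β' * boxQuadForm H a))) a ≤
    {v : LandauFree H × Fin 3 → ℝ | ∃ p, s / Real.sqrt 3 ≤ |v p|}.indicator
      (fun v => Real.exp (-(1/2 : ℝ) * (v ⬝ᵥ ((2 * β') • (hodgeQ H ⊗ₖ (1 : Matrix (Fin 3) (Fin 3) ℝ))) *ᵥ v))) (flatten (LandauFree H) a)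
  by_cases ha : a ∈ (smallField H s)ᶜ
  · have hmem : flatten (LandauFree H) a ∈ {v : LandauFree H × Fin 3 → ℝ | ∃ p, s / Real.sqrt 3 ≤ |v p|} :=
      exists_coord_of_not_smallField ha
    rw [Set.indicator_of_mem ha, Set.indicator_of_mem hmem, neg_mul_boxQuadForm_eq]
  · rw [Set.indicator_of_notMem ha]
    exact Set.indicator_nonneg (fun _ _ => (Real.exp_pos _).le) _

/-- Step 3a (diagonal of the inverse precision): `((2β′)·(hodgeQ ⊗ₖ 1₃))⁻¹ₚₚ = (2β′)⁻¹ · (hodgeQ⁻¹)_{ee}`, `p = (e, c)`. -/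
theorem precision_inv_diag {β' : ℝ} (hβ : 0 < β') (p : LandauFree H × Fin 3) :
    ((2 * β') • (hodgeQ H ⊗ₖ (1 : Matrix (Fin 3) (Fin 3) ℝ)))⁻¹ p p = (2 * β')⁻¹ * (hodgeQ H)⁻¹ p.1 p.1 := by
  have hdet : (hodgeQ H).det ≠ 0 := (hodgeQ_posDef H).det_pos.ne'
  rw [inv_smul_of_posDef (posDef_kronecker_one (hodgeQ H) (hodgeQ_posDef H)) (by positivity : (2 * β') ≠ 0),
    kronecker_one_inv (hodgeQ H) hdet, Matrix.smul_apply, smul_eq_mul, Matrix.kroneckerMap_apply, Matrix.one_apply_eq, mul_one]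

/-- Step 3b (one term): for a variance `0 < x ≤ (2β′)⁻¹·C₃`, `e^{−(s/√3)²/(2x)} ≤ e^{−β′s²/(3C₃)}`. -/
theorem exp_coord_tail_le {β' s C₃ x : ℝ} (hβ : 0 < β') (hC₃ : 0 < C₃) (hx : 0 < x) (hxle : x ≤ (2 * β')⁻¹ * C₃) :
    Real.exp (-((s / Real.sqrt 3) ^ 2 / (2 * x))) ≤ Real.exp (-(β' * s ^ 2 / (3 * C₃))) := by
  refine Real.exp_le_exp.2 (neg_le_neg ?_)
  have hρ : (s / Real.sqrt 3) ^ 2 = s ^ 2 / 3 := by rw [div_pow, Real.sq_sqrt (by norm_num : (0:ℝ) ≤ 3)]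
  rw [hρ, div_le_div_iff₀ (by positivity) (by positivity)]
  have hkey : 2 * β' * x ≤ C₃ := by
    have h := mul_le_mul_of_nonneg_left hxle (by positivity : (0:ℝ) ≤ 2 * β')
    rwa [← mul_assoc, mul_inv_cancel₀ (by positivity : (2 * β') ≠ 0), one_mul] at h
  nlinarith [mul_le_mul_of_nonneg_left hkey (sq_nonneg s)]

/-- Step 3 (union over the `3·|LandauFree H|` coordinates). -/
theorem sum_exp_coord_tail_le {β' s C₃ : ℝ} (hβ : 0 < β') (hC₃ : 0 < C₃) (hvar : ∀ e : LandauFree H, (hodgeQ H)⁻¹ e e ≤ C₃) :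
    ∑ p : LandauFree H × Fin 3, Real.exp (-((s / Real.sqrt 3) ^ 2 /
        (2 * ((2 * β') • (hodgeQ H ⊗ₖ (1 : Matrix (Fin 3) (Fin 3) ℝ)))⁻¹ p p))) ≤
      3 * Fintype.card (LandauFree H) * Real.exp (-(β' * s ^ 2 / (3 * C₃))) := by
  have hPd := posDef_precision (H := H) hβ
  calc ∑ p : LandauFree H × Fin 3, Real.exp (-((s / Real.sqrt 3) ^ 2 /
          (2 * ((2 * β') • (hodgeQ H ⊗ₖ (1 : Matrix (Fin 3) (Fin 3) ℝ)))⁻¹ p p)))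
      ≤ ∑ _p : LandauFree H × Fin 3, Real.exp (-(β' * s ^ 2 / (3 * C₃))) := Finset.sum_le_sum fun p _ => by
        refine exp_coord_tail_le hβ hC₃ hPd.inv.diag_pos ?_
        rw [precision_inv_diag hβ]
        exact mul_le_mul_of_nonneg_left (hvar p.1) (by positivity)
    _ = 3 * Fintype.card (LandauFree H) * Real.exp (-(β' * s ^ 2 / (3 * C₃))) := by
        rw [Finset.sum_const, Finset.card_univ, nsmul_eq_mul, Fintype.card_prod, Fintype.card_fin]
        push_cast
        ring

/-- **Relative Gaussian mass off the small-field box (6d in chart letters).**  For `β′ > 0`, `s ≥ 0` and a variance bound `(hodgeQ H)⁻¹ₑₑ ≤ C₃`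
(✓S3a `landauVarianceBounded`): `∫_{a ∉ smallField H s} e^{−β′Q(a)} ≤ 6·|LandauFree H|·e^{−β′s²/(3C₃)}·∫ e^{−β′Q}`, `Q = boxQuadForm H`. -/
theorem setIntegral_compl_smallField_exp_le {β' s C₃ : ℝ} (hβ : 0 < β') (hs : 0 ≤ s) (hC₃ : 0 < C₃)
    (hvar : ∀ e : LandauFree H, (hodgeQ H)⁻¹ e e ≤ C₃) :
    ∫ a in (smallField H s)ᶜ, Real.exp (-(β' * boxQuadForm H a)) ≤
      6 * Fintype.card (LandauFree H) * Real.exp (-(β' * s ^ 2 / (3 * C₃))) *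
        ∫ a : LandauFree H → E3, Real.exp (-(β' * boxQuadForm H a)) := by
  have hPd := posDef_precision (H := H) hβ
  have h1 := setIntegral_compl_smallField_le_flat (H := H) hβ s
  have hρ : 0 ≤ s / Real.sqrt 3 := div_nonneg hs (Real.sqrt_nonneg _)
  have h2 := setIntegral_exists_coord_tail_le hPd hρ
  have h3 := sum_exp_coord_tail_le (s := s) hβ hC₃ hvar
  have hZ : 0 ≤ Real.sqrt (2 * Real.pi) ^ Fintype.card (LandauFree H × Fin 3) /
      Real.sqrt ((2 * β') • (hodgeQ H ⊗ₖ (1 : Matrix (Fin 3) (Fin 3) ℝ))).det :=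
    div_nonneg (pow_nonneg (Real.sqrt_nonneg _) _) (Real.sqrt_nonneg _)
  rw [integral_exp_neg_mul_boxQuadForm hβ]
  refine h1.trans (h2.trans ?_)
  have h4 := mul_le_mul_of_nonneg_right (mul_le_mul_of_nonneg_left h3 (by norm_num : (0:ℝ) ≤ 2)) hZ
  refine h4.trans (le_of_eq ?_)
  ring

end ChartGauss

end Summit.QuantumFields.YangMills.Theorems.AllWindowsColdBoxBoxHighLine
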